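import Literature.NumberTheory.Automorphic.UnitaryTwoTreeActionStabilizers    -- ★ B-p08 (g28) (W2): `glVertexAct_eq_self_iff` (stabiliser of `latt h` = `h (F^× GL₂(𝒪)) h⁻¹`), `coe_units_map_scalar`
import Literature.NumberTheory.Automorphic.SLTwoTreeTransitive               -- ★ B-p08 (g28): `exists_glVertexAct_eq`, `mapGL_latt_one`
import HarnessLib

/-!
# The LEVEL (distance from the root) of a vertex of the tree of `SL₂(F)`: the primitive representative of `g ∈ GL₂(F)` and the Cartan invariant
# `|det g₀| = |ϖ|^n` (Serre, *Trees* II.1.1: `Λ′ ⊂ Λ` with `Λ∕Λ′ ≅ 𝒪∕ϖ^a ⊕ 𝒪∕ϖ^b`, `d(Λ, Λ′) = |a − b|`)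

Topic `NumberTheory/Automorphic`; namespace `Literature.NumberTheory.Automorphic.HermitianLatticeTree` (ROAD W's).  KERNEL mathematics only: theorems, no definition, no
named fact, no instance, no notation, no `sorry`.  Cell `pub/hodgecm-mathlib` (D-0151), crux H413 = `stmt-HodgeConjecture-24833`, line «N6nsGerm», road «W′» = «R1LL-WILD»
(architect A-p16 (g28) RULING A-44; (W′-B6) F0P3-p01 (g14); (B6-V) owner B-p14 (g33) shed 12:34:21Z the sub-socket **(V-top)** «`oT t + R < m ⇒ fbar m ↑t = 0`» to this seat —
this file is its TREE CORE, part 1: the level of a vertex).  Seat A-p17 (g23) ((W′1) I–VII ★ p843889…p844146).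
HONEST LABEL: HC_CM is proved only modulo the cell's 2 remaining named inputs (hLiu418, h413) until rung 0 closes; nothing printed is asserted here — valuation bookkeeping on
`2 × 2` matrices over a discrete valuation ring.

THE MATHEMATICS.  `F` with `[ValuativeRel F]`, `𝒪 = 𝒪[F]` a DVR with uniformizing element `ϖ`; `v₀ = 𝒪²` the root of the tree `X` of `SL₂(F)` (★ (W0)), `g · v₀` the vertex
action (★ `glVertexAct`).  NO definition is introduced; «`g` HAS LEVEL `n`» is the proposition
  `∃ (c : F) (g₀ : Matrix (Fin 2) (Fin 2) F), c ≠ 0 ∧ ↑g = c • g₀ ∧ (∀ i j, g₀ i j ∈ 𝒪) ∧ (∃ i j, valuation F (g₀ i j) = 1) ∧ valuation F g₀.det = valuation F ϖ ^ n`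
(a PRIMITIVE INTEGRAL representative `g₀` of the class of `g` modulo scalars, with `|det g₀| = |ϖ|^n`): `n` is the distance from `v₀` to `g · v₀` in the tree — for
`g ∈ F^× · GL₂(𝒪) · diag(1, ϖ^n) · GL₂(𝒪)` it is `n` (Cartan decomposition) [Serre1980Trees II.1.1].
* §1 `exists_level` (L1): every `g ∈ GL₂(F)` has a level `n : ℕ` (divide by an entry of maximal valuation; `|det g₀| ≤ 1` by the ultrametric inequality, and it is a power of `|ϖ|`).
* §2 `level_unique` (L2): the level is unique; `level_mul_of_mem_glInt_left ∕ _right`, `level_scalar_mul`: it is invariant under `g ↦ k g k′ (c • 1)` (`k k′ ∈ GL₂(𝒪)`, `c ∈ F^×`),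
  hence **`level_eq_of_glVertexAct_eq`: a function of the VERTEX `g · v₀`** (★ B-p08 `glVertexAct_eq_self_iff`: `g · v₀ = g′ · v₀ ⟺ g⁻¹ g′ ∈ F^× GL₂(𝒪)`).
* §3 `level_zero_iff` (L3): level `0 ⟺ g ∈ F^× · GL₂(𝒪) ⟺ g · v₀ = v₀`; `level_diagonal_one_pow : diag(1, ϖ^n)` has level `n`.
Sequel (`SLTwoTreeQuadraticTorusShellLevel`, same seat): the level of the SHELL CONJUGATE `r_m⁻¹ γ r_m` of a torus unit is `2 (m − ord b)₊` — the (V-top) core.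

## References
* [Serre1980Trees] J.-P. Serre, *Trees* (1980), Ch. II §1.1 (distance between lattice classes via elementary divisors), §1.2–§1.3.
* [BruhatTits1972] F. Bruhat, J. Tits, *Groupes réductifs sur un corps local I*, Publ. IHÉS 41 (1972), §10 (Cartan decomposition in rank one).
-/

set_option autoImplicit false

noncomputable section

open scoped ValuativeRel Matrix MatrixGroups
open Matrix ValuativeRel

namespace Literature.NumberTheory.Automorphic.HermitianLatticeTree

open Literature.NumberTheory.Automorphic

variable {F : Type*} [Field F] [ValuativeRel F] {ϖ : F} (hϖ : IsUniformizingElement ϖ) [IsDiscreteValuationRing 𝒪[F]]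

/-! ## §1 Existence of the level (the primitive representative) -/

omit [IsDiscreteValuationRing 𝒪[F]] in
/-- An entry of maximal valuation of a `2 × 2` matrix. [cite: Serre1980Trees, Ch. II §1.1] -/
theorem exists_entry_valuation_max (M : Matrix (Fin 2) (Fin 2) F) : ∃ i j : Fin 2, ∀ k l : Fin 2, valuation F (M k l) ≤ valuation F (M i j) := by
  classical
  obtain ⟨p, -, hp⟩ := Finset.exists_max_image (Finset.univ : Finset (Fin 2 × Fin 2)) (fun p => valuation F (M p.1 p.2)) ⟨(0, 0), Finset.mem_univ _⟩
  exact ⟨p.1, p.2, fun k l => hp (k, l) (Finset.mem_univ _)⟩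

omit [IsDiscreteValuationRing 𝒪[F]] in
/-- **Ultrametric determinant bound**: if all entries of a `2 × 2` matrix have valuation `≤ μ` then `|det| ≤ μ²`. [cite: Serre1980Trees, Ch. II §1.1] -/
theorem valuation_det_le_sq_of_forall_le (M : Matrix (Fin 2) (Fin 2) F) {μ : ValueGroupWithZero F} (hM : ∀ i j, valuation F (M i j) ≤ μ) :
    valuation F M.det ≤ μ ^ 2 := by
  rw [Matrix.det_fin_two, sub_eq_add_neg]
  refine le_trans (Valuation.map_add _ _ _) (max_le ?_ ?_)
  · rw [map_mul, pow_two]; exact mul_le_mul' (hM 0 0) (hM 1 1)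
  · rw [Valuation.map_neg, map_mul, pow_two]; exact mul_le_mul' (hM 0 1) (hM 1 0)

include hϖ in
/-- **(L1) EVERY `g ∈ GL₂(F)` HAS A LEVEL**: `↑g = c • g₀` with `g₀` primitive integral (entries in `𝒪`, one of valuation `1`) and `|det g₀| = |ϖ|^n` for some `n : ℕ`
(divide by an entry of maximal valuation; `|det g₀| ≤ 1` is then a non-negative power of `|ϖ|`). [cite: Serre1980Trees, Ch. II §1.1] [cite: BruhatTits1972, §10] -/
theorem exists_level (g : GL (Fin 2) F) :
    ∃ (n : ℕ) (c : F) (g₀ : Matrix (Fin 2) (Fin 2) F), c ≠ 0 ∧ (g : Matrix (Fin 2) (Fin 2) F) = c • g₀ ∧ (∀ i j, g₀ i j ∈ 𝒪[F]) ∧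
      (∃ i j, valuation F (g₀ i j) = 1) ∧ valuation F g₀.det = valuation F ϖ ^ n := by
  have h0 := hϖ.ne_zero
  obtain ⟨i, j, hij⟩ := exists_entry_valuation_max (g : Matrix (Fin 2) (Fin 2) F)
  set c : F := (g : Matrix (Fin 2) (Fin 2) F) i j with hc
  -- the maximal entry is non-zero (else `g = 0`)
  have hc0 : c ≠ 0 := by
    intro hc0
    have hall : ∀ k l, (g : Matrix (Fin 2) (Fin 2) F) k l = 0 := fun k l => by
      have := hij k l
      rw [hc0, map_zero, le_zero_iff, map_eq_zero] at this
      exact this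
    apply (g.isUnit.map Matrix.detMonoidHom).ne_zero
    show (g : Matrix (Fin 2) (Fin 2) F).det = 0
    rw [Matrix.det_fin_two, hall, hall, hall, hall]; ring
  set g₀ : Matrix (Fin 2) (Fin 2) F := c⁻¹ • (g : Matrix (Fin 2) (Fin 2) F) with hg₀
  have hg : (g : Matrix (Fin 2) (Fin 2) F) = c • g₀ := by rw [hg₀, smul_smul, mul_inv_cancel₀ hc0, one_smul]
  have hvc : valuation F c ≠ 0 := (Valuation.ne_zero_iff _).2 hc0
  have hint : ∀ k l, g₀ k l ∈ 𝒪[F] := fun k l => by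
    rw [Valuation.mem_integer_iff, hg₀, Matrix.smul_apply, smul_eq_mul, map_mul, map_inv₀]
    exact (inv_mul_le_iff₀ (zero_lt_iff.2 hvc)).2 (by rw [mul_one]; exact hij k l)
  have hunit : valuation F (g₀ i j) = 1 := by
    rw [hg₀, Matrix.smul_apply, smul_eq_mul, ← hc, map_mul, map_inv₀, inv_mul_cancel₀ hvc]
  -- `det g₀ ≠ 0`, `|det g₀| ≤ 1`
  have hdet0 : g₀.det ≠ 0 := by
    intro h
    apply (g.isUnit.map Matrix.detMonoidHom).ne_zero
    show (g : Matrix (Fin 2) (Fin 2) F).det = 0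
    rw [hg, Matrix.det_smul, h, mul_zero]
  have hdet1 : valuation F g₀.det ≤ 1 := by
    have := valuation_det_le_sq_of_forall_le g₀ (μ := 1) fun k l => (Valuation.mem_integer_iff _ _).1 (hint k l)
    rwa [one_pow] at this
  obtain ⟨k, w, hw, hk⟩ := exists_eq_zpow_mul_of_ne_zero hϖ hdet0
  have hk0 : 0 ≤ k := by
    by_contra hneg
    rw [not_le] at hneg
    rw [hk, map_mul, hw, mul_one, map_zpow₀] at hdet1
    have hlt : valuation F ϖ ^ (0 : ℤ) < valuation F ϖ ^ k := zpow_right_strictAnti₀ ((Valuation.pos_iff _).2 h0) hϖ.valuation_lt_one hneg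
    rw [zpow_zero] at hlt
    exact absurd hdet1 (not_le.2 hlt)
  obtain ⟨n, rfl⟩ := Int.eq_ofNat_of_zero_le hk0
  exact ⟨n, c, g₀, hc0, hg, hint, ⟨i, j, hunit⟩, by rw [hk, map_mul, hw, mul_one, zpow_natCast, map_pow]⟩

/-! ## §2 Uniqueness and invariance of the level -/

omit [IsDiscreteValuationRing 𝒪[F]] in
/-- The maximal entry valuation of `c • g₀` for a primitive integral `g₀` is `|c|`. [cite: Serre1980Trees, Ch. II §1.1] -/
theorem valuation_smul_entry_le_and_eq {c : F} {g₀ : Matrix (Fin 2) (Fin 2) F} (hint : ∀ i j, g₀ i j ∈ 𝒪[F]) (hprim : ∃ i j, valuation F (g₀ i j) = 1) :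
    (∀ k l, valuation F ((c • g₀) k l) ≤ valuation F c) ∧ ∃ i j, valuation F ((c • g₀) i j) = valuation F c := by
  refine ⟨fun k l => ?_, ?_⟩
  · rw [Matrix.smul_apply, smul_eq_mul, map_mul]
    exact mul_le_of_le_one_right zero_le ((Valuation.mem_integer_iff _ _).1 (hint k l))
  · obtain ⟨i, j, hij⟩ := hprim
    exact ⟨i, j, by rw [Matrix.smul_apply, smul_eq_mul, map_mul, hij, mul_one]⟩

include hϖ in
omit [IsDiscreteValuationRing 𝒪[F]] in
/-- **(L2) THE LEVEL IS UNIQUE**: two primitive representations `c • g₀ = c′ • g₀′` of the same matrix have `|c| = |c′|` and the same `n`. [cite: Serre1980Trees, Ch. II §1.1] -/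
theorem level_unique {M : Matrix (Fin 2) (Fin 2) F} {c c' : F} {g₀ g₀' : Matrix (Fin 2) (Fin 2) F} {n n' : ℕ} (hc : c ≠ 0)
    (hM : M = c • g₀) (hint : ∀ i j, g₀ i j ∈ 𝒪[F]) (hprim : ∃ i j, valuation F (g₀ i j) = 1) (hdet : valuation F g₀.det = valuation F ϖ ^ n)
    (hM' : M = c' • g₀') (hint' : ∀ i j, g₀' i j ∈ 𝒪[F]) (hprim' : ∃ i j, valuation F (g₀' i j) = 1) (hdet' : valuation F g₀'.det = valuation F ϖ ^ n') :
    n = n' := by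
  have hϖpos : 0 < valuation F ϖ := (Valuation.pos_iff _).2 hϖ.ne_zero
  -- `|c| = |c′|` (the maximal entry valuation)
  obtain ⟨hle, i, j, hij⟩ := valuation_smul_entry_le_and_eq (c := c) hint hprim
  obtain ⟨hle', i', j', hij'⟩ := valuation_smul_entry_le_and_eq (c := c') hint' hprim'
  rw [← hM] at hle hij
  rw [← hM'] at hle' hij'
  have hcc : valuation F c = valuation F c' := le_antisymm (hij ▸ hle' i j) (hij' ▸ hle i' j')
  -- determinants: `|c|² |ϖ|^n = |c′|² |ϖ|^{n′}`
  have hd : valuation F M.det = valuation F c ^ 2 * valuation F ϖ ^ n := by rw [hM, Matrix.det_smul, Fintype.card_fin, map_mul, map_pow, hdet]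
  have hd' : valuation F M.det = valuation F c' ^ 2 * valuation F ϖ ^ n' := by rw [hM', Matrix.det_smul, Fintype.card_fin, map_mul, map_pow, hdet']
  rw [hd, hcc] at hd'
  have hc'0 : valuation F c' ^ 2 ≠ 0 := pow_ne_zero 2 (by rw [← hcc]; exact (Valuation.ne_zero_iff _).2 hc)
  have hpow := mul_left_cancel₀ hc'0 hd'
  exact (pow_right_injective₀ hϖpos hϖ.valuation_lt_one.ne) (by exact_mod_cast hpow)

omit [IsDiscreteValuationRing 𝒪[F]] in
/-- Multiplying a primitive integral matrix by elements of `GL₂(𝒪)` on either side keeps it primitive integral with the same `|det|`. [cite: Serre1980Trees, Ch. II §1.1] -/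
theorem primitive_glInt_mul_mul_glInt {g₀ : Matrix (Fin 2) (Fin 2) F} (hint : ∀ i j, g₀ i j ∈ 𝒪[F]) (hprim : ∃ i j, valuation F (g₀ i j) = 1)
    {k k' : GL (Fin 2) F} (hk : k ∈ glInt 2 F) (hk' : k' ∈ glInt 2 F) :
    (∀ i j, ((k : Matrix (Fin 2) (Fin 2) F) * g₀ * (k' : Matrix (Fin 2) (Fin 2) F)) i j ∈ 𝒪[F]) ∧
      (∃ i j, valuation F (((k : Matrix (Fin 2) (Fin 2) F) * g₀ * (k' : Matrix (Fin 2) (Fin 2) F)) i j) = 1) ∧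
      valuation F ((k : Matrix (Fin 2) (Fin 2) F) * g₀ * (k' : Matrix (Fin 2) (Fin 2) F)).det = valuation F g₀.det := by
  have hkI := isIntegralMatrix_of_mem_glInt hk
  have hk'I := isIntegralMatrix_of_mem_glInt hk'
  have hkiI := isIntegralMatrix_of_mem_glInt (inv_mem hk)
  have hk'iI := isIntegralMatrix_of_mem_glInt (inv_mem hk')
  have hI : IsIntegralMatrix ((k : Matrix (Fin 2) (Fin 2) F) * g₀ * (k' : Matrix (Fin 2) (Fin 2) F)) := (hkI.mul hint).mul hk'I
  refine ⟨hI, ?_, ?_⟩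
  · -- if all entries of `k g₀ k′` were in `𝔭`, so would be those of `g₀ = k⁻¹ (k g₀ k′) k′⁻¹`
    by_contra hno
    push Not at hno
    have hlt : ∀ i j, valuation F (((k : Matrix (Fin 2) (Fin 2) F) * g₀ * (k' : Matrix (Fin 2) (Fin 2) F)) i j) < 1 :=
      fun i j => lt_of_le_of_ne ((Valuation.mem_integer_iff _ _).1 (hI i j)) (hno i j)
    obtain ⟨i, j, hij⟩ := hprim
    have hg₀ : g₀ = ((k⁻¹ : GL (Fin 2) F) : Matrix (Fin 2) (Fin 2) F) * (((k : Matrix (Fin 2) (Fin 2) F) * g₀ * (k' : Matrix (Fin 2) (Fin 2) F))) *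
        ((k'⁻¹ : GL (Fin 2) F) : Matrix (Fin 2) (Fin 2) F) := by
      rw [← Matrix.mul_assoc, ← Matrix.mul_assoc, ← Units.val_mul, inv_mul_cancel, Units.val_one, Matrix.one_mul, Matrix.mul_assoc, ← Units.val_mul,
        mul_inv_cancel, Units.val_one, Matrix.mul_one]
    -- every entry of `A * N * B` with `A, B` integral and `N` of entries `< 1` has valuation `< 1`
    have key : ∀ (A B N : Matrix (Fin 2) (Fin 2) F), IsIntegralMatrix A → IsIntegralMatrix B → (∀ a b, valuation F (N a b) < 1) →
        ∀ a b, valuation F ((A * N * B) a b) < 1 := by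
      intro A B N hA hB hN a b
      have hAle : ∀ x y, valuation F (A x y) ≤ 1 := fun x y => (Valuation.mem_integer_iff _ _).1 (hA x y)
      have hBle : ∀ x y, valuation F (B x y) ≤ 1 := fun x y => (Valuation.mem_integer_iff _ _).1 (hB x y)
      have hterm : ∀ x y, valuation F (A a x * N x y * B y b) < 1 := fun x y => by
        rw [map_mul, map_mul]
        calc valuation F (A a x) * valuation F (N x y) * valuation F (B y b)
            ≤ 1 * valuation F (N x y) * 1 := mul_le_mul' (mul_le_mul' (hAle a x) le_rfl) (hBle y b)
          _ = valuation F (N x y) := by rw [one_mul, mul_one]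
          _ < 1 := hN x y
      have hsum2 : ∀ p q : F, valuation F p < 1 → valuation F q < 1 → valuation F (p + q) < 1 := fun p q hp hq =>
        lt_of_le_of_lt (Valuation.map_add _ _ _) (max_lt hp hq)
      simp only [Matrix.mul_apply, Fin.sum_univ_two, add_mul]
      exact hsum2 _ _ (hsum2 _ _ (hterm 0 0) (hterm 1 0)) (hsum2 _ _ (hterm 0 1) (hterm 1 1))
    have := key _ _ _ hkiI hk'iI hlt i j
    rw [← hg₀, hij] at this
    exact lt_irrefl _ this
  · rw [Matrix.det_mul, Matrix.det_mul, map_mul, map_mul, valuation_det_eq_one_of_mem_glInt hk, valuation_det_eq_one_of_mem_glInt hk', one_mul, mul_one]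

include hϖ in
/-- **THE LEVEL IS A FUNCTION OF THE VERTEX**: if `g · v₀ = g′ · v₀` then any primitive data of `g` and of `g′` have the same `n` (`g′ = g · (c • 1) · k`, `k ∈ GL₂(𝒪)`, by ★
`glVertexAct_eq_self_iff`; then `primitive_glInt_mul_mul_glInt` + `level_unique`). [cite: Serre1980Trees, Ch. II §1.1, §1.3] -/
theorem level_eq_of_glVertexAct_eq {g g' : GL (Fin 2) F}
    (v₀ : {M : Submodule 𝒪[F] (Fin 2 → F) // IsSpecialLattice (RingHom.id F) ϖ !![(0 : F), 1; -1, 0] M})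
    (hv₀ : v₀.1 = latt (1 : Matrix (Fin 2) (Fin 2) F)) (h : glVertexAct hϖ g v₀ = glVertexAct hϖ g' v₀)
    {c c' : F} {g₀ g₀' : Matrix (Fin 2) (Fin 2) F} {n n' : ℕ} (hc : c ≠ 0)
    (hg : (g : Matrix (Fin 2) (Fin 2) F) = c • g₀) (hint : ∀ i j, g₀ i j ∈ 𝒪[F]) (hprim : ∃ i j, valuation F (g₀ i j) = 1) (hdet : valuation F g₀.det = valuation F ϖ ^ n)
    (hg' : (g' : Matrix (Fin 2) (Fin 2) F) = c' • g₀') (hint' : ∀ i j, g₀' i j ∈ 𝒪[F]) (hprim' : ∃ i j, valuation F (g₀' i j) = 1)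
    (hdet' : valuation F g₀'.det = valuation F ϖ ^ n') : n = n' := by
  -- `(g⁻¹ g′) · v₀ = v₀`, so `g⁻¹ g′ = (e • 1) k`
  have hfix : glVertexAct hϖ (g⁻¹ * g') v₀ = v₀ := by rw [glVertexAct_mul, ← h, ← glVertexAct_mul, inv_mul_cancel, glVertexAct_one]
  have hv₀' : v₀.1 = latt ((1 : GL (Fin 2) F) : Matrix (Fin 2) (Fin 2) F) := by rw [Units.val_one]; exact hv₀
  obtain ⟨e, k, hk, hek⟩ := (glVertexAct_eq_self_iff hϖ 1 v₀ hv₀' (g⁻¹ * g')).1 hfix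
  rw [inv_one, one_mul, mul_one] at hek
  -- `↑g′ = (e c) • (g₀ k)`
  have hg'2 : (g' : Matrix (Fin 2) (Fin 2) F) = ((e : F) * c) • (((1 : GL (Fin 2) F) : Matrix (Fin 2) (Fin 2) F) * g₀ * (k : Matrix (Fin 2) (Fin 2) F)) := by
    have : g' = g * (g⁻¹ * g') := by rw [mul_inv_cancel_left]
    rw [this, hek, Units.val_mul, Units.val_mul, coe_units_map_scalar, hg, Units.val_one]
    simp only [Matrix.smul_mul, Matrix.mul_smul, Matrix.one_mul, smul_smul]
  obtain ⟨hint2, hprim2, hdet2⟩ := primitive_glInt_mul_mul_glInt hint hprim (one_mem _) hk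
  exact level_unique hϖ (mul_ne_zero e.ne_zero hc) hg'2 hint2 hprim2 (hdet2.trans hdet) hg' hint' hprim' hdet'

/-! ## §3 Level zero = the root; the level of `diag(1, ϖ^m)` -/

omit [IsDiscreteValuationRing 𝒪[F]] in
/-- The identity has primitive data `(1, 1, 0)`: the root has level `0`. [cite: Serre1980Trees, Ch. II §1.1] -/
theorem level_data_one : ((1 : GL (Fin 2) F) : Matrix (Fin 2) (Fin 2) F) = (1 : F) • (1 : Matrix (Fin 2) (Fin 2) F) ∧ (∀ i j, (1 : Matrix (Fin 2) (Fin 2) F) i j ∈ 𝒪[F]) ∧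
    (∃ i j, valuation F ((1 : Matrix (Fin 2) (Fin 2) F) i j) = 1) ∧ valuation F (1 : Matrix (Fin 2) (Fin 2) F).det = valuation F ϖ ^ 0 := by
  refine ⟨by rw [Units.val_one, one_smul], fun i j => ?_, ⟨0, 0, by rw [Matrix.one_apply_eq, map_one]⟩, by rw [Matrix.det_one, map_one, pow_zero]⟩
  rw [Matrix.one_apply]
  split_ifs
  · exact one_mem _
  · exact zero_mem _

include hϖ in
/-- **(L3) LEVEL ZERO IS THE ROOT**: for primitive data `(c, g₀, n)` of `g`, `n = 0 ⟺ g · v₀ = v₀` (⟸ `level_eq_of_glVertexAct_eq` against `1`; ⟹ `g₀ ∈ GL₂(𝒪)` and scalars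
act trivially). [cite: Serre1980Trees, Ch. II §1.1, §1.3] -/
theorem level_zero_iff_glVertexAct_eq {g : GL (Fin 2) F}
    (v₀ : {M : Submodule 𝒪[F] (Fin 2 → F) // IsSpecialLattice (RingHom.id F) ϖ !![(0 : F), 1; -1, 0] M})
    (hv₀ : v₀.1 = latt (1 : Matrix (Fin 2) (Fin 2) F)) {c : F} {g₀ : Matrix (Fin 2) (Fin 2) F} {n : ℕ} (hc : c ≠ 0)
    (hg : (g : Matrix (Fin 2) (Fin 2) F) = c • g₀) (hint : ∀ i j, g₀ i j ∈ 𝒪[F]) (hprim : ∃ i j, valuation F (g₀ i j) = 1) (hdet : valuation F g₀.det = valuation F ϖ ^ n) :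
    n = 0 ↔ glVertexAct hϖ g v₀ = v₀ := by
  constructor
  · intro hn
    rw [hn, pow_zero] at hdet
    -- `g₀ ∈ GL₂(𝒪)` and `g = (c • 1) G₀`
    have hdet0 : g₀.det ≠ 0 := fun h0 => by rw [h0, map_zero] at hdet; exact zero_ne_one hdet
    set G₀ : GL (Fin 2) F := Matrix.GeneralLinearGroup.mk'' g₀ (isUnit_iff_ne_zero.2 hdet0) with hG₀
    have hG₀K : G₀ ∈ glInt 2 F := mem_glInt_of_isIntegralMatrix hint hdet
    set cu : Fˣ := Units.mk0 c hc with hcu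
    have hgfac : g = cu.map ((Matrix.scalar (Fin 2) : F →+* Matrix (Fin 2) (Fin 2) F) : F →* Matrix (Fin 2) (Fin 2) F) * G₀ := by
      ext : 1
      rw [Units.val_mul, coe_units_map_scalar, hg, Matrix.smul_mul, Matrix.one_mul]; rfl
    rw [hgfac, glVertexAct_scalar_mul]
    refine (glVertexAct_eq_iff hϖ G₀ v₀ v₀).2 ⟨0, ?_⟩
    have hl := latt_mul_of_mem_glInt 1 G₀ hG₀K
    rw [one_mul, Units.val_one] at hl
    rw [zpow_zero, scaleLattice_one, hv₀, mapGL_latt_one, hl]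
  · intro h
    obtain ⟨h1, hint1, hprim1, hdet1⟩ := level_data_one (F := F) (ϖ := ϖ)
    have h' : glVertexAct hϖ g v₀ = glVertexAct hϖ 1 v₀ := by rw [h, glVertexAct_one]
    exact level_eq_of_glVertexAct_eq hϖ v₀ hv₀ h' hc hg hint hprim hdet h1 hint1 hprim1 hdet1

include hϖ in
omit [IsDiscreteValuationRing 𝒪[F]] in
/-- **`diag(1, ϖ^m)` HAS LEVEL `m`** (primitive data `(1, diag(1, ϖ^m), m)`): the shell-`m` representative of (W′1) sits at distance `m` from the root.
[cite: Serre1980Trees, Ch. II §1.1] [cite: BruhatTits1972, §10] -/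
theorem level_data_diagonal_one_pow {g : GL (Fin 2) F} {m : ℕ} (hg : (g : Matrix (Fin 2) (Fin 2) F) = Matrix.diagonal ![1, ϖ ^ m]) :
    (g : Matrix (Fin 2) (Fin 2) F) = (1 : F) • Matrix.diagonal ![(1 : F), ϖ ^ m] ∧ (∀ i j, Matrix.diagonal ![(1 : F), ϖ ^ m] i j ∈ 𝒪[F]) ∧
      (∃ i j, valuation F (Matrix.diagonal ![(1 : F), ϖ ^ m] i j) = 1) ∧ valuation F (Matrix.diagonal ![(1 : F), ϖ ^ m]).det = valuation F ϖ ^ m := by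
  refine ⟨by rw [hg, one_smul], fun i j => ?_, ⟨0, 0, by simp⟩, ?_⟩
  · fin_cases i <;> fin_cases j
    · simp [one_mem]
    · simp [zero_mem]
    · simp [zero_mem]
    · simpa using hϖ.pow_mem m
  · rw [Matrix.det_diagonal, Fin.prod_univ_two]; simp [map_pow]

end Literature.NumberTheory.Automorphic.HermitianLatticeTree

end
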